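import Summits.Ventures.CertifiedQuantumChemistry.Certificates.HubbardRingL6SingletLiftBlockG0Face
import Summits.Ventures.CertifiedQuantumChemistry.Certificates.HubbardRingL6SingletLiftBlockGudFace
import Summits.Ventures.CertifiedQuantumChemistry.Certificates.HubbardRingL6SingletLiftBlockGduFace
import Summits.Ventures.CertifiedQuantumChemistry.Certificates.HubbardRingL6SingletLiftPairPSD
import Summits.Ventures.CertifiedQuantumChemistry.Certificates.HubbardRingL6LiftPHPSD
import HarnessLib

/-!
# Ventures/CertifiedQuantumChemistry — Certificates/HubbardRingL6SingletLiftPHPSD.lean: LAYER 1 (particle–hole blocks) of the L = 6 DQG+S²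
# (singlet) lift assembly — the `G`-matrix `Gˢ(ε)` of the exact singlet lift family, on the 144 ordered-pair codes, DEFINED as the
# scatter-sum of the landed singlet particle–hole block tables (`G_0` 72 | `ud` 36 | `du` 36, each through its facial reduction), is
# positive semidefinite for `0 < ε ≤ 2⁻⁵¹`

HONEST FRAMING (verbatim): certified bounds for a stated model Hamiltonian in a stated basis; not a
claim about the real molecule beyond that model. Auxiliary objects; no model energy is bounded here.

Seat rdm-B (gen 43; the DQG+S² twin of gen 42's `…L6LiftPHPSD.lean`, whose index tables `l6LabH/l6PosH`, block sizes `l6szH`, unit signs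
`l6oneH` and scatter lemmas are REUSED). Unlike the DQG lift, ALL THREE particle–hole blocks of the singlet lift carry one forced kernel
direction (`G_0`: 72 → 71; `G_ud`, `G_du`: 36 → 35), so every block enters through its `…Face.lean` (`l6sG0_psd72`, `l6sGud_psd36`,
`l6sGdu_psd36`). THE THEOREM **`l6srealGm_posSemidef`**: `Gˢ(ε) ⪰ 0` (real `144 × 144`) for `0 < ε ≤ 2⁻⁵¹`. 0 sorry; standard axioms.
-/

set_option linter.style.longLine false

namespace Summit.Ventures.CertifiedQuantumChemistry

namespace LiftL6

open Matrix Finset PencilRat BlockScatter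

/-! ## §1 The coefficient matrices `Gˢ_j` as scatter-sums, and the real family -/

/-- The singlet lift's `G` particle–hole block coefficient tables by block number (each on its FULL coordinates). -/
noncomputable def l6sblkH : (b : ℕ) → Fin 3 → Fin (l6szH b) → Fin (l6szH b) → ℚ
  | 0 => l6sG0X72
  | 1 => l6sGudX36
  | 2 => l6sGduX36
  | _ + 3 => fun _ _ _ => 0

/-- **`Gˢ_j`** (rational, on the 144 ordered-pair codes): the scatter-sum of the singlet lift's particle–hole blocks' `j`-th coefficient. -/
noncomputable def l6sGm (j : Fin 3) : Matrix (Fin 144) (Fin 144) ℚ :=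
  ∑ b ∈ Finset.range 3, scatterS (l6szH b) l6LabH l6PosH l6oneH b (Matrix.of fun a c => l6sblkH b j a c)

/-- The real `G`-matrix family `Gˢ(ε) = Σ_j ε^j Gˢ_j`. -/
noncomputable def l6srealGm (ε : ℝ) : Matrix (Fin 144) (Fin 144) ℝ := ∑ j : Fin 3, (ε ^ (j : ℕ)) • (l6sGm j).map (Rat.cast : ℚ → ℝ)

/-! ## §2 Linearity and positivity -/

/-- **`Gˢ(ε)` is the scatter-sum of the real `G` block families.** -/
theorem l6srealGm_eq_sum_scatterS (ε : ℝ) : ∀ I J, l6srealGm ε I J =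
    ∑ b ∈ Finset.range 3, scatterS (l6szH b) l6LabH l6PosH (fun _ => (1 : ℝ)) b (realXQ (l6sblkH b) ε) I J := by
  intro I J
  have hR : ∀ b, scatterS (l6szH b) l6LabH l6PosH (fun _ => (1 : ℝ)) b (realXQ (l6sblkH b) ε) =
      ∑ j : Fin 3, (ε ^ (j : ℕ)) • scatterS (l6szH b) l6LabH l6PosH (fun _ => (1 : ℝ)) b
        ((Matrix.of fun a c => l6sblkH b j a c).map (Rat.cast : ℚ → ℝ)) := by
    intro b
    rw [realXQ, scatterS_sum6]
    refine Finset.sum_congr rfl fun j _ => ?_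
    rw [scatterS_smul6]
    rfl
  simp_rw [hR]
  simp only [l6srealGm, l6sGm, Matrix.sum_apply, Matrix.smul_apply, Matrix.map_apply, smul_eq_mul, Rat.cast_sum, cast_scatterH6,
    Finset.mul_sum]
  rw [Finset.sum_comm]

/-- **LAYER 1 (`G`-matrix): `Gˢ(ε) ⪰ 0`** for `0 < ε ≤ 2⁻⁵¹` — the three particle–hole block certificates (each through its facial
reduction) assembled by the scatter-sum. -/
theorem l6srealGm_posSemidef {ε : ℝ} (hε0 : 0 < ε) (hε1 : ε ≤ 1 / 2 ^ 51) : (l6srealGm ε).PosSemidef := by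
  have hε1' : ε ≤ 1 := hε1.trans (by norm_num)
  refine posSemidef_of_eq_sum_scatterS 3 l6szH l6LabH l6PosH (fun _ _ => (1 : ℝ)) (fun b => realXQ (l6sblkH b) ε)
    (fun b hb => ?_) (l6srealGm_eq_sum_scatterS ε)
  interval_cases b
  · refine l6sG0_psd72 hε0 hε1' ?_
    have h : (1 : ℝ) / 2 ^ 51 * ((l6sG0rho1 + l6sG0rho2 : ℚ) : ℝ) ≤ (l6sG0mu : ℝ) := by norm_num [l6sG0rho1, l6sG0rho2, l6sG0mu]
    have h0 : (0 : ℝ) ≤ ((l6sG0rho1 + l6sG0rho2 : ℚ) : ℝ) := by norm_num [l6sG0rho1, l6sG0rho2]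
    nlinarith
  · refine l6sGud_psd36 hε0 hε1' ?_
    have h : (1 : ℝ) / 2 ^ 51 * ((l6sGudrho1 + l6sGudrho2 : ℚ) : ℝ) ≤ (l6sGudmu : ℝ) := by norm_num [l6sGudrho1, l6sGudrho2, l6sGudmu]
    have h0 : (0 : ℝ) ≤ ((l6sGudrho1 + l6sGudrho2 : ℚ) : ℝ) := by norm_num [l6sGudrho1, l6sGudrho2]
    nlinarith
  · refine l6sGdu_psd36 hε0 hε1' ?_
    have h : (1 : ℝ) / 2 ^ 51 * ((l6sGdurho1 + l6sGdurho2 : ℚ) : ℝ) ≤ (l6sGdumu : ℝ) := by norm_num [l6sGdurho1, l6sGdurho2, l6sGdumu]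
    have h0 : (0 : ℝ) ≤ ((l6sGdurho1 + l6sGdurho2 : ℚ) : ℝ) := by norm_num [l6sGdurho1, l6sGdurho2]
    nlinarith

end LiftL6

end Summit.Ventures.CertifiedQuantumChemistry
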